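import Mathlib

/-!
# Hadamard 668 census, family F12 — algebra for Lander's parity theorem at p = 29 over 𝔽₁₆₇ (kernel)

Framing: lottery ticket; floor = certified bounds/negative ranges.

Cell pub-namedobj (venture DiscreteObjects), target (H), hadamard gen 8.  The census excludes automorphisms of order `29`
of the 2-(667,333,166) design by Lander's parity theorem (Symmetric Designs: An Algebraic Approach, 1983, Thm 3.20(2):
`167⁷ ≡ -1 (mod 29)`, so an automorphism of order `29` fixes an odd number of points, whereas the kernel theorem
`automorphism_29_fixedPointFree` says it fixes none).  This file supplies the field-theoretic input of a direct kernel proof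
of that instance, with `F = ZMod 167` and `h` ANY irreducible factor of the cyclotomic polynomial `Φ₂₉` over `F`:
* `dvd_comp_X_pow_28_of_dvd_cyclotomic29` — SELF-RECIPROCITY: `h ∣ h(X²⁸)`, i.e. with the root `α` of `h` in `F[X]/(h)` also
  `α⁻¹ = α²⁸` is a root; because `α²⁸ = α^(167⁷)` (`167⁷ ≡ 28 (mod 29)`) is the image of `α` under the 7-th power of
  Frobenius, a ring endomorphism fixing the coefficients;
* `isCoprime_of_mul_eq_X_pow_29_sub_one` (separability of `X²⁹ - 1`, `29 ≠ 0` in `F`), `eval_one_ne_zero_of_dvd_cyclotomic29`,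
  `eval_one_eq_zero_of_mul_eq`;
* `natDegree_dvd_finrank_of_aeval_eq_zero` — if an endomorphism `φ` of a finite-dimensional `F`-space `M` satisfies
  `h(φ) = 0` with `h` irreducible then `deg h ∣ dim M` (tower law over the field `F[X]/(h)`, Mathlib
  `Module.IsTorsionBySet.module` + `Module.finrank_mul_finrank`).
Ours, not literature; no `sorry`; general field facts, stated for the numbers the census needs.  Reference for the
theorem being re-proved in this special case: [cite: book:lander1983-symmetric-designs-algebraic-approach, Thm 3.20(2) p.95].
-/

open Polynomial

namespace Summit.Ventures.DiscreteObjects.Hadamard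

/-- `167⁷ ≡ 28 ≡ -1 (mod 29)`: the prime `167` is self-conjugate modulo `29` -/
lemma pow_seven_167_mod_29 : 167 ^ 7 % 29 = 28 := by norm_num

section zmod167
/-! Throughout, `Fact (Nat.Prime 167)` (so that `ZMod 167` is a field) is an instance ARGUMENT, discharged by `⟨by norm_num⟩`
where the lemmas are used; no global instance is declared. -/
variable [Fact (Nat.Prime 167)]

/-- `Φ₂₉ · (X - 1) = X²⁹ - 1` over `𝔽₁₆₇` -/
lemma cyclotomic29_mul_X_sub_one : cyclotomic 29 (ZMod 167) * (X - 1) = X ^ 29 - 1 := by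
  haveI : Fact (Nat.Prime 29) := ⟨by norm_num⟩
  exact cyclotomic_prime_mul_X_sub_one (ZMod 167) 29

/-- `Φ₂₉ ∣ X²⁹ - 1` over `𝔽₁₆₇` -/
lemma cyclotomic29_dvd_X_pow_sub_one : cyclotomic 29 (ZMod 167) ∣ X ^ 29 - 1 :=
  ⟨X - 1, cyclotomic29_mul_X_sub_one.symm⟩

/-- `deg Φ₂₉ = 28` over `𝔽₁₆₇` -/
lemma natDegree_cyclotomic29 : (cyclotomic 29 (ZMod 167)).natDegree = 28 := by
  rw [natDegree_cyclotomic]; decide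

/-- a factor of `Φ₂₉` does not vanish at `1` (`Φ₂₉(1) = 29 ≠ 0` in `𝔽₁₆₇`) -/
lemma eval_one_ne_zero_of_dvd_cyclotomic29 {h : (ZMod 167)[X]} (hdvd : h ∣ cyclotomic 29 (ZMod 167)) :
    h.eval 1 ≠ 0 := by
  haveI : Fact (Nat.Prime 29) := ⟨by norm_num⟩
  obtain ⟨g, hg⟩ := hdvd
  intro h0
  have e : (cyclotomic 29 (ZMod 167)).eval 1 = 0 := by rw [hg, eval_mul, h0, zero_mul]
  rw [eval_one_cyclotomic_prime, ZMod.natCast_eq_zero_iff] at e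
  revert e
  norm_num

/-- the complementary factor vanishes at `1` -/
lemma eval_one_eq_zero_of_mul_eq {h h' : (ZMod 167)[X]} (hh' : h * h' = X ^ 29 - 1) (h1 : h.eval 1 ≠ 0) :
    h'.eval 1 = 0 := by
  have e := congrArg (eval 1) hh'
  simp only [eval_mul, eval_sub, eval_pow, eval_X, one_pow, eval_one, sub_self] at e
  exact (mul_eq_zero.mp e).resolve_left h1

/-- complementary factors of the separable polynomial `X²⁹ - 1` over `𝔽₁₆₇` are coprime -/
lemma isCoprime_of_mul_eq_X_pow_29_sub_one {h h' : (ZMod 167)[X]} (hh' : h * h' = X ^ 29 - 1) :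
    IsCoprime h h' := by
  have hsep : (X ^ 29 - 1 : (ZMod 167)[X]).Separable := by
    have h29 : ((29 : ℕ) : ZMod 167) ≠ 0 := by rw [Ne, ZMod.natCast_eq_zero_iff]; norm_num
    have := separable_X_pow_sub_C (1 : ZMod 167) h29 one_ne_zero
    simpa using this
  rw [← hh'] at hsep
  exact hsep.isCoprime

/-- **Self-reciprocity.** An irreducible factor `h` of `Φ₂₉` over `𝔽₁₆₇` divides `h(X²⁸)`: with the root `α` of `h` in the
field `𝔽₁₆₇[X]/(h)`, `α²⁹ = 1` and `α²⁸ = α^(167⁷) = Frob⁷(α)` is again a root of `h`. -/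
theorem dvd_comp_X_pow_28_of_dvd_cyclotomic29 {h : (ZMod 167)[X]} (hirr : Irreducible h)
    (hdvd : h ∣ cyclotomic 29 (ZMod 167)) : h ∣ h.comp (X ^ 28) := by
  haveI : Fact (Irreducible h) := ⟨hirr⟩
  set K := AdjoinRoot h with hK
  set α : K := AdjoinRoot.root h with hα
  -- α^29 = 1
  have hα29 : α ^ 29 = 1 := by
    obtain ⟨g, hg⟩ := dvd_trans hdvd cyclotomic29_dvd_X_pow_sub_one
    have e : aeval α (X ^ 29 - 1 : (ZMod 167)[X]) = 0 := by
      rw [hg, map_mul, AdjoinRoot.aeval_eq, AdjoinRoot.mk_self, zero_mul]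
    rw [map_sub, map_pow, aeval_X, map_one, sub_eq_zero] at e
    exact e
  -- Frobenius⁷ on K
  haveI : CharP K 167 := charP_of_injective_algebraMap (algebraMap (ZMod 167) K).injective 167
  haveI : ExpChar K 167 := ExpChar.prime (by norm_num)
  let ψ : K →+* K := iterateFrobenius K 167 7
  have hψα : ψ α = α ^ 28 := by
    show iterateFrobenius K 167 7 α = α ^ 28
    rw [iterateFrobenius_def, ← Nat.div_add_mod (167 ^ 7) 29, pow_add, pow_mul, hα29, one_pow, one_mul,
      pow_seven_167_mod_29]
  have hcomp : ψ.comp (algebraMap (ZMod 167) K) = algebraMap (ZMod 167) K := Subsingleton.elim _ _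
  -- h(α^28) = ψ (h(α)) = 0
  have hroot : h.eval₂ (algebraMap (ZMod 167) K) (α ^ 28) = 0 := by
    have e := Polynomial.hom_eval₂ h (algebraMap (ZMod 167) K) ψ α
    rw [hcomp, hψα] at e
    rw [← e]
    have h0 : h.eval₂ (algebraMap (ZMod 167) K) α = 0 := AdjoinRoot.eval₂_root h
    rw [h0, map_zero]
  -- hence h ∣ h.comp (X^28)
  rw [← AdjoinRoot.mk_eq_zero, ← AdjoinRoot.aeval_eq, aeval_comp, map_pow, aeval_X]
  exact hroot

end zmod167

/-- **Degree divisibility.** If an endomorphism `φ` of a finite-dimensional vector space `M` over a field `F` satisfies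
`h(φ) = 0` for an irreducible `h`, then `deg h` divides `dim M` (`M` is a vector space over the field `F[X]/(h)`). -/
theorem natDegree_dvd_finrank_of_aeval_eq_zero {F : Type*} [Field F] {M : Type*} [AddCommGroup M] [Module F M]
    [FiniteDimensional F M] (φ : M →ₗ[F] M) {h : F[X]} (hirr : Irreducible h) (hφ : aeval φ h = 0) :
    h.natDegree ∣ Module.finrank F M := by
  haveI : Fact (Irreducible h) := ⟨hirr⟩
  have htors : Module.IsTorsionBySet F[X] (Module.AEval' φ) (Ideal.span {h} : Set F[X]) := by
    rw [show ((Ideal.span {h} : Ideal F[X]) : Set F[X]) = (Submodule.span F[X] {h} : Set F[X]) from rfl,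
      Module.isTorsionBySet_span_singleton_iff]
    intro m
    obtain ⟨v, rfl⟩ := (Module.AEval'.of φ).surjective m
    change h • Module.AEval.of F M φ v = 0
    rw [← Module.AEval.of_aeval_smul, hφ, zero_smul, map_zero]
  letI : Module (AdjoinRoot h) (Module.AEval' φ) := htors.module
  haveI : IsScalarTower F (AdjoinRoot h) (Module.AEval' φ) :=
    Module.IsTorsionBySet.isScalarTower (S := F) htors
  have e1 : Module.finrank F (AdjoinRoot h) = h.natDegree := by
    rw [(AdjoinRoot.powerBasis hirr.ne_zero).finrank, AdjoinRoot.powerBasis_dim]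
  have e2 : Module.finrank F (Module.AEval' φ) = Module.finrank F M := (Module.AEval'.of φ).finrank_eq.symm
  have e3 := Module.finrank_mul_finrank F (AdjoinRoot h) (Module.AEval' φ)
  rw [e1, e2] at e3
  exact ⟨_, e3.symm⟩

end Summit.Ventures.DiscreteObjects.Hadamard
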